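import Summits.NavierStokesRegularity.NavierStokesRegularity.Theorems.SoloSalvageWu2026Step341
import Summits.NavierStokesRegularity.NavierStokesRegularity.Theorems.SoloSalvageWu2026ConstructTools
import Literature.Analysis.FluidPDE.NormalisedPressureAffine
import HarnessLib

/-!
# C177 `Wu2026` — toward `Step_construct` (B), pressure compactness (3.45): the rescaled pressures
# ARE the canonical pressures of the blow-downs, `P_j = p̃[V_j]` (3.39), with scale-free bounds

Seat `ns-in-wu-341` (D-0154 (2) INPUTS, director-ns req136; A3 Wu 2026 — its KEY `Step_341` landed
as `step_341`; this seat then took sub-binder (B) of `step_construct_of_pieces`, cut owner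
`ns-inputs-plan`, holder of `Step_construct` = seat `ns-in-wu-con`). Salvage conventions: theorems
only, standard axioms, no definition, no named fact; `--supports` item 0897.

Print (arXiv:2608.22471v1, p.14 l.46 – p.15 l.16): «Set P_j(y) = R_j^{4/3} p(R_j y) … The
normalization commutes with dilation: P_j = R_iR_k(V_{j,i}V_{j,k}). (3.39) Indeed, both sides are
obtained from their unscaled counterparts by the same factor R_j^{4/3}, while the second-order Riesz
transform is homogeneous of degree zero.» … «sup_j (‖P_j‖_{L^{9/4,∞}} + ‖Q_j‖_{L^{9/4,∞}}) ≤ C (3.43)».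

* `eq_of_memWeakLp_sub_const` — the canonical constant is unique: `p − c, p − c' ∈ L^{r,∞}(ℝ³)`
  forces `c = c'` (a nonzero constant has infinite distribution function on `ℝ³`);
* `sub_const_ae_eq_normalisedPressure` — hence for ANY `c` with `p − c ∈ L^{9/4,∞}` (the `c` that
  `Step_construct` quantifies over), `p − c = p̃[v]` a.e. (from (3.36),
  `exists_pressure_sub_const_ae_eq_normalisedPressure`);
* `blowDownP_ae_eq_normalisedPressure_blowDown` — (3.39): `P_R := R^{4/3}(p − c)(R·) = p̃[V_R]` a.e.,
  `V_R = R^{2/3}v(R·)` (dilation covariance `normalisedPressure_smul_comp_affine` + invariance of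
  null sets under `y ↦ Ry`);
* `eWeakLpPow_blowDown_le`, `eWeakLpPow_blowDownP_le` — (3.20)/(3.43): the weak quasinorms of
  `V_R`, `P_R` are bounded by those of `v`, `p − c`, uniformly in `R` (exact scaling of the
  distribution function, `meas_lt_norm_rescaled_le` of `…ConstructTools`);
* `exists_forall_norm_blowDown_le`, `memLp_blowDown` — `V_R` is bounded and lies in every `L^q`,
  `9/2 < q < ∞`;
* `setLIntegral_enorm_le_of_eWeakLpPow_le`, `setLIntegral_rpow_four_le_of_eWeakLpPow_le` — the
  scale-free `L¹(S)` / `L⁴(S)` bounds on sets of finite measure consumed by the local compactness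
  argument («the finite-measure embedding on U», p.15 l.28).

WHAT THIS IS NOT: not a proof of `Step_construct`; not a claim about NS regularity or blow-up; not
a claim about any author beyond the typed locator.
-/

noncomputable section

set_option linter.dupNamespace false

open MeasureTheory Set Function Filter Topology Metric
open scoped ENNReal NNReal RealInnerProductSpace

namespace Summit.NavierStokesRegularity.NavierStokesRegularity.Theorems.Wu2026Salvage

open Literature.Claims.NS.Wu2026 Literature.Analysis.FluidPDE Literature.Analysis.FunctionSpaces

/-! ### Uniqueness of the canonical constant -/

/-- A nonzero constant is not weak-`L^r` on `ℝ³` (any `r`): its distribution function at the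
level `|d|/2` is `|ℝ³| = ∞`. [folklore] -/
theorem not_memWeakLp_const {d : ℝ} (hd : d ≠ 0) (r : ℝ≥0∞) :
    ¬ MemWeakLp (fun _ : E3 => d) r volume := by
  intro h
  have ht : 0 < |d| / 2 := by positivity
  have hle := ofReal_rpow_mul_meas_lt_le_eWeakLpPow (fun _ : E3 => d) r volume ht
  have hset : {x : E3 | |d| / 2 < ‖d‖} = univ := by
    refine eq_univ_of_forall fun x => ?_
    simp only [mem_setOf_eq, Real.norm_eq_abs]
    linarith [abs_pos.2 hd]
  rw [hset, measure_univ_of_isAddLeftInvariant, ENNReal.mul_top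
    (ENNReal.ofReal_pos.2 (Real.rpow_pos_of_pos ht _)).ne'] at hle
  exact absurd (top_le_iff.1 hle) h.2.ne

/-- **Uniqueness of the canonical constant**: if `q − c` and `q − c'` are both weak-`L^r` on `ℝ³`
(`0 < r < ∞`) then `c = c'` (their difference is a weak-`L^r` constant). [folklore] -/
theorem eq_of_memWeakLp_sub_const {q : E3 → ℝ} {c c' : ℝ} {r : ℝ≥0∞} (hr : 0 < r.toReal)
    (hc : MemWeakLp (fun x => q x - c) r volume) (hc' : MemWeakLp (fun x => q x - c') r volume) :
    c = c' := by
  by_contra hne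
  have hneg : MemWeakLp (fun x => -(q x - c')) r volume :=
    memWeakLp_mono_norm hc' hc'.1.neg fun x => by rw [norm_neg]
  have hsum := memWeakLp_add hc hneg hr
  have heq : (fun x => q x - c + -(q x - c')) = fun _ : E3 => c' - c := by
    funext x; ring
  rw [heq] at hsum
  exact not_memWeakLp_const (sub_ne_zero.2 (Ne.symm hne)) r hsum

/-- **(3.36) for the constant of `Step_construct`**: for an `IsWuFlow` with `v ∈ L^{9/2,∞}` and ANY
`c` with `p − c ∈ L^{9/4,∞}`, `p − c = p̃[v]` a.e. (the canonical constant of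
`exists_pressure_sub_const_ae_eq_normalisedPressure` is the only one, `eq_of_memWeakLp_sub_const`).
[cite: Wu2026, (3.36) p.14 l.29–45] -/
theorem sub_const_ae_eq_normalisedPressure {ν : ℝ} {v : E3 → E3} {p : E3 → ℝ}
    (hf : IsWuFlow ν v p) (hvw : MemWeakLp v ((9 : ℝ≥0∞) / 2) volume) {c : ℝ}
    (hpc : MemWeakLp (fun x => p x - c) ((9 : ℝ≥0∞) / 4) volume) :
    (fun x => p x - c) =ᵐ[volume] normalisedPressure v := by
  obtain ⟨c₀, hc₀⟩ := exists_pressure_sub_const_ae_eq_normalisedPressure hf hvw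
  have hlt6 : (9 : ℝ≥0∞) / 2 < 2 * 3 := by
    rw [ENNReal.div_lt_iff (Or.inl (by norm_num)) (Or.inl (by norm_num))]
    norm_num
  have hv6 : MemLp v (2 * 3) volume := memLp_of_isWuFlow hf hvw hlt6 (by norm_num)
  have hPw : MemWeakLp (normalisedPressure v) ((9 : ℝ≥0∞) / 4) volume :=
    memWeakLp_normalisedPressure_nine_fourths hf.smooth_v.continuous hvw hv6
  have hc₀w : MemWeakLp (fun x => p x - c₀) ((9 : ℝ≥0∞) / 4) volume :=
    MemWeakLp.congr_ae hPw hc₀.symm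
  have h94 : (0 : ℝ) < ((9 : ℝ≥0∞) / 4).toReal := by rw [toReal_nine_quarters]; norm_num
  have hcc : c = c₀ := eq_of_memWeakLp_sub_const h94 hpc hc₀w
  rw [hcc]
  exact hc₀

/-! ### (3.39): the rescaled pressure is the canonical pressure of the blow-down -/

/-- **(3.39) `P_R = p̃[V_R]` a.e.** for `P_R(y) = R^{4/3}(p − c)(Ry)` (`blowDownP`),
`V_R(y) = R^{2/3}v(Ry)` (`blowDown`), `R > 0`: the dilation covariance of the canonical pressure
(`normalisedPressure_smul_comp_affine`: `p̃[α u(γ·)](y) = α² p̃[u](γy)`) and (3.36) transported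
along `y ↦ Ry` (which preserves null sets). [cite: Wu2026, (3.39) p.14 l.54–61] -/
theorem blowDownP_ae_eq_normalisedPressure_blowDown {ν : ℝ} {v : E3 → E3} {p : E3 → ℝ}
    (hf : IsWuFlow ν v p) (hvw : MemWeakLp v ((9 : ℝ≥0∞) / 2) volume) {c : ℝ}
    (hpc : MemWeakLp (fun x => p x - c) ((9 : ℝ≥0∞) / 4) volume) {R : ℝ} (hR : 0 < R) :
    blowDownP R (fun x => p x - c) =ᵐ[volume] normalisedPressure (blowDown R v) := by
  have h1 := sub_const_ae_eq_normalisedPressure hf hvw hpc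
  have hq : Measure.QuasiMeasurePreserving (fun y : E3 => R • y) volume volume :=
    Measure.quasiMeasurePreserving_smul volume hR.ne'
  have h2 := hq.ae_eq_comp h1
  have hbd : blowDown R v = fun y => (R ^ ((2 : ℝ) / 3)) • v ((0 : E3) + R • y) := by
    funext y; simp only [blowDown, zero_add]
  have hpow : (R ^ ((2 : ℝ) / 3)) ^ 2 = R ^ ((4 : ℝ) / 3) := by
    rw [← Real.rpow_natCast, ← Real.rpow_mul hR.le]; norm_num
  filter_upwards [h2] with y hy
  simp only [Function.comp] at hy
  show R ^ ((4 : ℝ) / 3) * (p (R • y) - c) = normalisedPressure (blowDown R v) y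
  rw [hbd, normalisedPressure_smul_comp_affine v (0 : E3) (R ^ ((2 : ℝ) / 3)) hR y, zero_add, hpow,
    hy]

/-! ### Scale-free weak bounds -/

/-- **(3.20)**: `‖V_R‖^{9/2}_{9/2,∞} ≤ ‖v‖^{9/2}_{9/2,∞}` for every `R > 0`. [cite: Wu2026, (3.20) p.10 l.55 – p.11 l.3] -/
theorem eWeakLpPow_blowDown_le (v : E3 → E3) {R : ℝ} (hR : 0 < R) :
    eWeakLpPow (blowDown R v) ((9 : ℝ≥0∞) / 2) volume ≤ eWeakLpPow v ((9 : ℝ≥0∞) / 2) volume := by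
  refine eWeakLpPow_le_of_forall (by rw [toReal_nine_halves]; norm_num) fun t ht => ?_
  rw [toReal_nine_halves]
  calc ENNReal.ofReal (t ^ ((9 : ℝ) / 2)) * volume {y | t < ‖blowDown R v y‖}
      ≤ ENNReal.ofReal (t ^ ((9 : ℝ) / 2)) * (eWeakLpPow v ((9 : ℝ≥0∞) / 2) volume *
          ENNReal.ofReal (t ^ (-((9 : ℝ) / 2)))) :=
        mul_le_mul' le_rfl (meas_lt_norm_blowDown_le v hR ht)
    _ = ENNReal.ofReal (t ^ ((9 : ℝ) / 2) * t ^ (-((9 : ℝ) / 2))) *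
          eWeakLpPow v ((9 : ℝ≥0∞) / 2) volume := by
        rw [ENNReal.ofReal_mul (Real.rpow_nonneg ht.le _)]; ring
    _ = eWeakLpPow v ((9 : ℝ≥0∞) / 2) volume := by
        rw [← Real.rpow_add ht, add_neg_cancel, Real.rpow_zero, ENNReal.ofReal_one, one_mul]

/-- **(3.43)**: `‖P_R‖^{9/4}_{9/4,∞} ≤ ‖q‖^{9/4}_{9/4,∞}` for `P_R = R^{4/3}q(R·)`, every `R > 0`
(«because 4/3 − 3/(9/4) = 0», p.15 l.12). [cite: Wu2026, (3.43) p.15 l.8–12] -/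
theorem eWeakLpPow_blowDownP_le (q : E3 → ℝ) {R : ℝ} (hR : 0 < R) :
    eWeakLpPow (blowDownP R q) ((9 : ℝ≥0∞) / 4) volume ≤ eWeakLpPow q ((9 : ℝ≥0∞) / 4) volume := by
  refine eWeakLpPow_le_of_forall (by rw [toReal_nine_quarters]; norm_num) fun t ht => ?_
  rw [toReal_nine_quarters]
  have h := meas_lt_norm_rescaled_le q (blowDownP R q) hR (a := (4 : ℝ) / 3) (r := (9 : ℝ) / 4)
    (by norm_num) _ toReal_nine_quarters (fun y => by
      unfold blowDownP
      rw [norm_mul, Real.norm_of_nonneg (Real.rpow_nonneg hR.le _)]) ht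
  calc ENNReal.ofReal (t ^ ((9 : ℝ) / 4)) * volume {y | t < ‖blowDownP R q y‖}
      ≤ ENNReal.ofReal (t ^ ((9 : ℝ) / 4)) * (eWeakLpPow q ((9 : ℝ≥0∞) / 4) volume *
          ENNReal.ofReal (t ^ (-((9 : ℝ) / 4)))) := mul_le_mul' le_rfl h
    _ = ENNReal.ofReal (t ^ ((9 : ℝ) / 4) * t ^ (-((9 : ℝ) / 4))) *
          eWeakLpPow q ((9 : ℝ≥0∞) / 4) volume := by
        rw [ENNReal.ofReal_mul (Real.rpow_nonneg ht.le _)]; ring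
    _ = eWeakLpPow q ((9 : ℝ≥0∞) / 4) volume := by
        rw [← Real.rpow_add ht, add_neg_cancel, Real.rpow_zero, ENNReal.ofReal_one, one_mul]

/-- `V_R ∈ L^{9/2,∞}` for continuous `v ∈ L^{9/2,∞}`. [cite: Wu2026, (3.20)–(3.21) p.10–11] -/
theorem memWeakLp_blowDown {v : E3 → E3} (hv : Continuous v)
    (hvw : MemWeakLp v ((9 : ℝ≥0∞) / 2) volume) {R : ℝ} (hR : 0 < R) :
    MemWeakLp (blowDown R v) ((9 : ℝ≥0∞) / 2) volume :=
  ⟨(continuous_blowDown hv R).aestronglyMeasurable, (eWeakLpPow_blowDown_le v hR).trans_lt hvw.2⟩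

/-- `V_R` is bounded (by `R^{2/3} sup|v|`) for the velocity of an `IsWuFlow`. [folklore] -/
theorem exists_forall_norm_blowDown_le {ν : ℝ} {v : E3 → E3} {p : E3 → ℝ} (hf : IsWuFlow ν v p)
    {R : ℝ} (hR : 0 < R) : ∃ M : ℝ, 0 < M ∧ ∀ y, ‖blowDown R v y‖ ≤ M := by
  obtain ⟨M, hM0, hM⟩ := exists_forall_norm_le_of_decay hf.smooth_v.continuous hf.decay
  refine ⟨R ^ ((2 : ℝ) / 3) * M, by positivity, fun y => ?_⟩
  unfold blowDown
  rw [norm_smul, Real.norm_of_nonneg (Real.rpow_nonneg hR.le _)]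
  exact mul_le_mul_of_nonneg_left (hM _) (Real.rpow_nonneg hR.le _)

/-- **`V_R ∈ L^q(ℝ³)` for `9/2 < q < ∞`** (bounded and weak-`L^{9/2}`). [cite: Wu2026, (3.20) p.10] -/
theorem memLp_blowDown {ν : ℝ} {v : E3 → E3} {p : E3 → ℝ} (hf : IsWuFlow ν v p)
    (hvw : MemWeakLp v ((9 : ℝ≥0∞) / 2) volume) {R : ℝ} (hR : 0 < R) {q : ℝ≥0∞}
    (hq : (9 : ℝ≥0∞) / 2 < q) (hqt : q ≠ ⊤) : MemLp (blowDown R v) q volume := by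
  obtain ⟨M, hM0, hM⟩ := exists_forall_norm_blowDown_le hf hR
  exact MemWeakLp.memLp_of_norm_le (memWeakLp_blowDown hf.smooth_v.continuous hvw hR) hM0 hM hq hqt

/-- `V_R ∈ L⁶ = L^{2·3}` — the Lebesgue class on which the tree's Calderón–Zygmund theory of
`p̃[V_R]` is stated. [cite: Wu2026, (3.20) p.10] -/
theorem memLp_two_mul_three_blowDown {ν : ℝ} {v : E3 → E3} {p : E3 → ℝ} (hf : IsWuFlow ν v p)
    (hvw : MemWeakLp v ((9 : ℝ≥0∞) / 2) volume) {R : ℝ} (hR : 0 < R) :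
    MemLp (blowDown R v) (2 * 3) volume := by
  refine memLp_blowDown hf hvw hR ?_ (by norm_num)
  rw [ENNReal.div_lt_iff (Or.inl (by norm_num)) (Or.inl (by norm_num))]
  norm_num

/-! ### Scale-free local bounds on sets of finite measure -/

/-- **`L¹(S)` bound from a weak-`L^{9/4}` bound**: `∫_S |f| ≤ |S| + (4/5) W` whenever
`‖f‖^{9/4}_{9/4,∞} ≤ W` (layer cake split at height `1`). [cite: Wu2026, p.15 l.28–31 («finite-measure embedding»)] -/
theorem setLIntegral_enorm_le_of_eWeakLpPow_le {F : Type*} [NormedAddCommGroup F] {f : E3 → F}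
    (hfm : AEStronglyMeasurable f volume) (S : Set E3) {W : ℝ≥0∞}
    (hW : eWeakLpPow f ((9 : ℝ≥0∞) / 4) volume ≤ W) :
    ∫⁻ y in S, ‖f y‖ₑ ≤ volume S + ENNReal.ofReal (4 / 5) * W := by
  have h := MemWeakLp.setLIntegral_rpow_le (f := f) (p := (9 : ℝ≥0∞) / 4) (μ := volume) hfm
    (r := 1) one_pos (by rw [toReal_nine_quarters]; norm_num) S one_pos
  rw [toReal_nine_quarters] at h
  simp only [ENNReal.rpow_one, Real.one_rpow, ENNReal.ofReal_one, mul_one] at h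
  refine h.trans (add_le_add le_rfl ?_)
  refine (mul_le_mul' le_rfl hW).trans_eq' ?_
  congr 2
  norm_num

/-- **`L⁴(S)` bound from a weak-`L^{9/2}` bound**: `∫_S |g|⁴ ≤ |S| + 8 W` whenever
`‖g‖^{9/2}_{9/2,∞} ≤ W` (layer cake split at height `1`; `q₀ = 4 < 9/2`). [cite: Wu2026, (3.26) p.11 l.13–28] -/
theorem setLIntegral_rpow_four_le_of_eWeakLpPow_le {F : Type*} [NormedAddCommGroup F] {g : E3 → F}
    (hgm : AEStronglyMeasurable g volume) (S : Set E3) {W : ℝ≥0∞}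
    (hW : eWeakLpPow g ((9 : ℝ≥0∞) / 2) volume ≤ W) :
    ∫⁻ y in S, ‖g y‖ₑ ^ (4 : ℝ) ≤ volume S + ENNReal.ofReal 8 * W := by
  have h := MemWeakLp.setLIntegral_rpow_le (f := g) (p := (9 : ℝ≥0∞) / 2) (μ := volume) hgm
    (r := 4) (by norm_num) (by rw [toReal_nine_halves]; norm_num) S one_pos
  rw [toReal_nine_halves] at h
  simp only [Real.one_rpow, ENNReal.ofReal_one, mul_one] at h
  refine h.trans (add_le_add le_rfl ?_)
  refine (mul_le_mul' le_rfl hW).trans_eq' ?_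
  congr 2
  norm_num

end Summit.NavierStokesRegularity.NavierStokesRegularity.Theorems.Wu2026Salvage

end

-- WHAT THIS IS NOT: not a claim about NS regularity or blow-up; not a claim about any author beyond the typed locator.
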